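import Literature.Barriers.CriticalPhenomena.RigorousRGSmallParameterCovarianceDecomposition
import HarnessLib

/-!
# `RigorousRGSmallParameter` (Slade, Theorem 1.4.1): the mass derivative of the covariance
# decomposition — `∂ρ/∂A` (10.9), `∂C_j/∂m²` under the Kato integral, and Lemma 10.1.4 with `q = 1`

Companion of `RigorousRGSmallParameterCovarianceIntegrals.lean` ((10.9) for `ρ`, Lemmas
10.1.3–10.1.4 with `q = 0`), `RigorousRGSmallParameterCovarianceBound.lean` (Proposition 3.3.1
(3.9), `q = 0`) and `RigorousRGSmallParameterCovarianceDecomposition.lean` (continuity in `m²`)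
in the proof architecture of the barrier `RigorousRGSmallParameter.lean`. Source: G. Slade,
*Critical exponents for long-range `O(n)` models below the upper critical dimension*, Commun.
Math. Phys. **358** (2018) 343–436, arXiv:1611.06169: Proposition 3.3.1 / Proposition 10.1.1, the
`∂/∂m²` display ("For `m²L^{α(j-1)} ∈ (0,1]`, … `|∂/∂m² ∇^aC_{j;x,y}| ≤ cL^{(ε-|a|)(j-1)} × …`"), and
§10.1: "(10.9) `0 ≤ ρ(s,A) ≲ s^β/(s^β+A)²`, `|∂ρ(s,A)/∂A| ≲ s^β/(s^β+A)³`"; "We consider these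
together, with `q ∈ {0,1}` denoting the number of `m²`-derivatives. Now we change notation, and
write `ρ^{(q)}` for the `q`th derivative of `ρ` with respect to `A`, for `q = 0,1`"; Lemma 10.1.4
("`I_1(γ,β,q,A) = ∫₀¹ds s^γ/(s^β+A)^{2+q}`, `I_2(γ,β,q,A) = ∫₁^∞ds s^γ/(s^β+A)^{2+q}` … Let
`r = (2+q)-(γ+1)/β` … `I_1 ≲ A^{-r} (A ≤ 1, r > 0, γ ≠ log)`; proof: "since the `σ`-integral converges at
infinity we obtain (set `s = σA^{1/β}`) `I_1 = A^{-r}∫₀^{A^{-1/β}}dσ σ^γ/(σ^β+1)^{2+q} ≲ A^{-r}`").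

## What this file proves (everything; two definitions, no named fact)

* `Kato.katoDenom` (the denominator `D(s,a) = s^{2β}+a²+2as^βcos πβ` of `ρ^{(β)}`),
  `Kato.katoDensityDeriv` (`∂ρ^{(β)}(s,a)/∂a = -(sin πβ/π)s^β(2a+2s^βcos πβ)/D²`),
  `Kato.hasDerivAt_katoDenom`, **`Kato.hasDerivAt_katoDensity_mass`** (the mass derivative of
  Kato's density exists at every real `a`, `s > 0`), **`Kato.abs_katoDensityDeriv_le`** — (10.9),
  second bound, with an explicit constant: `|∂_aρ| ≤ (8 sin πβ/(π(1+cos πβ)²)) s^β/(s^β+a)³`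
  (`a ≥ 0`), `Kato.abs_katoDensityDeriv_le_inv_mul_rpow_neg` (`≤ c a⁻¹s^{-β}`),
  `Kato.continuous_katoDensityDeriv_mass`, `Kato.measurable_katoDensityDeriv`.
* **`FRD.hasDerivAt_fracCov_mass`** — for `m² > 0`, `m² ↦ C_{j;0,x}(m²)` is differentiable with
  `∂C_{j;0,x}/∂m² = ∫₀^∞Γ_{j;0,x}(s)∂_Aρ^{(α/2)}(s,m²)ds` (dominated differentiation under (3.8); the
  integrand of the `q = 1` case of Proposition 10.1.1), with the integrability of that integrand;
  `FRD.integrableOn_abs_Gam_mul_rpow_div_cube`, **`FRD.abs_deriv_fracCov_mass_le`**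
  (`|∂C_{j;0,x}/∂m²| ≤ c_β∫₀^∞|Γ_{j;0,x}(s)|s^β/(s^β+m²)³ds`, the starting point of the `q = 1`
  estimate).
* **Lemma 10.1.4 with `q = 1`** (cube denominators), PROVED in the instances used for the
  `∂/∂m²` display: `CovBound.setIntegral_rpow_div_cube_Ioi_le` (`∫_T^∞s^γ/(s^β+A)³ ≤
  T^{γ-3β+1}/(3β-γ-1)`, "`A ≤ 1, r > 0`"), `CovBound.setIntegral_rpow_div_cube_Ioc_le'`
  (`∫₀^Ts^γ/(s^β+A)³ ≤ A⁻³T^{γ+1}/(γ+1)`, "`A ≥ 1, γ > -1`"), and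
  **`CovBound.setIntegral_rpow_div_cube_Ioc_le_rpow_neg`** — the scaling bound
  `∫₀^Ts^γ/(s^β+A)³ ≤ (1/(γ+1)+1/(3β-γ-1))A^{-r}`, `r = 3-(γ+1)/β > 0`, the case "`A ≤ 1, r > 0`" of
  `I_1` (here for every `A > 0` and every `T`; the `s`-range is split at `A^{1/β}` instead of the
  printed substitution `s = σA^{1/β}`), with the continuity/integrability helpers
  `CovBound.continuousOn_rpow_div_cube`, `CovBound.rpow_div_cube_le_rpow_sub`,
  `CovBound.rpow_div_cube_le_inv_cube_mul`, `CovBound.integrableOn_rpow_div_cube_Ioc/Ioi`.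

Scope: the `log` case of `I_1` (`γ = log`, `d = 2`) is not treated (the sequel absorbs the
logarithm into an arbitrarily small power, as the paper itself does in the proof of Lemma 5.2.4).
-/

noncomputable section

namespace Literature.Barriers.CriticalPhenomena

open _root_.MeasureTheory Set Filter
open scoped _root_.Topology Real

namespace LongRangePhi4

namespace Kato

/-! ### The mass derivative of Kato's density -/

/-- The denominator `D(s,a) = s^{2β} + a² + 2a s^β cos πβ` of `ρ^{(β)}(s,a)`.
[cite: Slade2017, §2.1.2 (display (2.15))] -/
def katoDenom (β a s : ℝ) : ℝ := s ^ (2 * β) + a ^ 2 + 2 * a * s ^ β * Real.cos (π * β)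

/-- **`∂ρ^{(β)}(s,a)/∂a = -(sin πβ/π) s^β (2a + 2s^β cos πβ)/D(s,a)²`** — the mass derivative of
Kato's density ("we write `ρ^{(q)}` for the `q`th derivative of `ρ` with respect to `A`, for
`q = 0,1`"). [cite: Slade2017, §10.1 (display (10.9) and the proof of Proposition 10.1.1, "ρ^{(q)}")] -/
def katoDensityDeriv (β a s : ℝ) : ℝ :=
  -(Real.sin (π * β) / π) * (s ^ β * (2 * a + 2 * s ^ β * Real.cos (π * β)) / katoDenom β a s ^ 2)

/-- `ρ^{(β)}(s,a) = (sin πβ/π) s^β/D(s,a)`. [cite: Slade2017, §2.1.2 (display (2.15))] -/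
theorem katoDensity_eq_div_katoDenom (β a s : ℝ) :
    katoDensity β a s = Real.sin (π * β) / π * (s ^ β / katoDenom β a s) := rfl

/-- `a ↦ D(s,a)` has derivative `2a + 2s^β cos πβ`. [folklore] -/
theorem hasDerivAt_katoDenom (β s a : ℝ) :
    HasDerivAt (fun a => katoDenom β a s) (2 * a + 2 * s ^ β * Real.cos (π * β)) a := by
  unfold katoDenom
  have h1 : HasDerivAt (fun a : ℝ => a ^ 2) (2 * a) a := by simpa using hasDerivAt_pow 2 a
  have h2 : HasDerivAt (fun a : ℝ => a * (2 * s ^ β * Real.cos (π * β)))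
      (1 * (2 * s ^ β * Real.cos (π * β))) a := (hasDerivAt_id a).mul_const _
  have h := (h1.const_add (s ^ (2 * β))).fun_add h2
  have e : (fun a : ℝ => s ^ (2 * β) + a ^ 2 + 2 * a * s ^ β * Real.cos (π * β)) =
      fun a => s ^ (2 * β) + a ^ 2 + a * (2 * s ^ β * Real.cos (π * β)) := by
    funext a
    ring
  rw [e]
  refine h.congr_deriv ?_
  ring

/-- **The mass derivative of Kato's density exists** at every real `a` (`s > 0`, `β ∈ (0,1)`; the
denominator never vanishes) and equals `katoDensityDeriv`. [cite: Slade2017, §10.1 ("ρ^{(q)} … the q-th derivative of ρ with respect to A")] -/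
theorem hasDerivAt_katoDensity_mass {β : ℝ} (hβ0 : 0 < β) (hβ1 : β < 1) {s : ℝ} (hs : 0 < s) (a : ℝ) :
    HasDerivAt (fun a => katoDensity β a s) (katoDensityDeriv β a s) a := by
  have hD : katoDenom β a s ≠ 0 := (katoDenom_pos hβ0 hβ1 a hs).ne'
  have h := ((hasDerivAt_const a (s ^ β)).div (hasDerivAt_katoDenom β s a) hD).const_mul
    (Real.sin (π * β) / π)
  simp only [zero_mul, zero_sub] at h
  refine h.congr_deriv ?_
  unfold katoDensityDeriv
  ring

/-- **(10.9), second bound: `|∂ρ(s,A)/∂A| ≲ s^β/(s^β+A)³`** with an explicit constant, for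
`A ≥ 0`, `s > 0`, `β ∈ (0,1)`: `|∂_Aρ| ≤ (8 sin πβ/(π(1+cos πβ)²)) s^β/(s^β+A)³` (from
`|2A + 2s^βcos πβ| ≤ 2(s^β+A)` and `D ≥ ½(1+cos πβ)(s^β+A)²`).
[cite: Slade2017, §10.1 (display (10.9), second bound)] -/
theorem abs_katoDensityDeriv_le {β : ℝ} (hβ0 : 0 < β) (hβ1 : β < 1) {a : ℝ} (ha : 0 ≤ a)
    {s : ℝ} (hs : 0 < s) :
    |katoDensityDeriv β a s| ≤
      8 * Real.sin (π * β) / (π * (1 + Real.cos (π * β)) ^ 2) * (s ^ β / (s ^ β + a) ^ 3) := by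
  have hsin : 0 < Real.sin (π * β) := Real.sin_pos_of_pos_of_lt_pi (by positivity)
    (by nlinarith [Real.pi_pos])
  have hκ := one_add_cos_pos hβ0 hβ1
  have hsb : 0 < s ^ β := Real.rpow_pos_of_pos hs _
  have hπ := Real.pi_pos
  have hS : 0 < s ^ β + a := by linarith
  have hD : (1 + Real.cos (π * β)) / 2 * (s ^ β + a) ^ 2 ≤ katoDenom β a s := katoDenom_ge_sq β a hs
  have hD0 : 0 < katoDenom β a s := katoDenom_pos hβ0 hβ1 a hs
  have hnum : |2 * a + 2 * s ^ β * Real.cos (π * β)| ≤ 2 * (s ^ β + a) := by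
    rw [abs_le]
    have hc1 := Real.cos_le_one (π * β)
    have hc2 := Real.neg_one_le_cos (π * β)
    constructor <;> nlinarith
  unfold katoDensityDeriv
  rw [abs_mul, abs_neg, abs_of_pos (div_pos hsin hπ), abs_div, abs_mul, abs_of_pos hsb,
    abs_of_pos (pow_pos hD0 2)]
  -- compare the two fractions
  have hD2 : ((1 + Real.cos (π * β)) / 2 * (s ^ β + a) ^ 2) ^ 2 ≤ katoDenom β a s ^ 2 :=
    pow_le_pow_left₀ (by positivity) hD 2
  have hq0 : 0 < ((1 + Real.cos (π * β)) / 2 * (s ^ β + a) ^ 2) ^ 2 := by positivity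
  calc Real.sin (π * β) / π * (s ^ β * |2 * a + 2 * s ^ β * Real.cos (π * β)| / katoDenom β a s ^ 2)
      ≤ Real.sin (π * β) / π * (s ^ β * (2 * (s ^ β + a)) /
          ((1 + Real.cos (π * β)) / 2 * (s ^ β + a) ^ 2) ^ 2) := by
        gcongr
    _ = 8 * Real.sin (π * β) / (π * (1 + Real.cos (π * β)) ^ 2) * (s ^ β / (s ^ β + a) ^ 3) := by
        field_simp
        ring

/-- The crude consequence `|∂ρ(s,A)/∂A| ≤ c A⁻¹ s^{-β}` for `A > 0` (from `s^β/(s^β+A)³ ≤ s^{-β}/A`),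
used to dominate the derivative locally uniformly in `A`. [cite: Slade2017, §10.1 (display (10.9))] -/
theorem abs_katoDensityDeriv_le_inv_mul_rpow_neg {β : ℝ} (hβ0 : 0 < β) (hβ1 : β < 1) {a : ℝ}
    (ha : 0 < a) {s : ℝ} (hs : 0 < s) :
    |katoDensityDeriv β a s| ≤
      8 * Real.sin (π * β) / (π * (1 + Real.cos (π * β)) ^ 2) * (a⁻¹ * s ^ (-β)) := by
  refine (abs_katoDensityDeriv_le hβ0 hβ1 ha.le hs).trans ?_
  have hsin : 0 < Real.sin (π * β) := Real.sin_pos_of_pos_of_lt_pi (by positivity)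
    (by nlinarith [Real.pi_pos])
  have hκ := one_add_cos_pos hβ0 hβ1
  have hπ := Real.pi_pos
  refine mul_le_mul_of_nonneg_left ?_ (by positivity)
  have hsb : 0 < s ^ β := Real.rpow_pos_of_pos hs _
  have hS : 0 < s ^ β + a := by linarith
  rw [Real.rpow_neg hs.le, div_le_iff₀ (pow_pos hS 3)]
  -- s^β ≤ a⁻¹ s^{-β} (s^β + a)^3
  have h1 : s ^ β * s ^ β * a ≤ (s ^ β + a) ^ 3 := by
    calc s ^ β * s ^ β * a = a * (s ^ β) ^ 2 := by ring
      _ ≤ (s ^ β + a) * (s ^ β + a) ^ 2 :=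
          mul_le_mul (by linarith) (pow_le_pow_left₀ hsb.le (by linarith) 2) (sq_nonneg _) hS.le
      _ = (s ^ β + a) ^ 3 := by ring
  calc s ^ β = a⁻¹ * (s ^ β)⁻¹ * (s ^ β * s ^ β * a) := by field_simp
    _ ≤ a⁻¹ * (s ^ β)⁻¹ * (s ^ β + a) ^ 3 := by gcongr

/-- `a ↦ ∂_aρ(s,a)` is continuous (`s > 0`). [folklore] -/
theorem continuous_katoDensityDeriv_mass {β : ℝ} (hβ0 : 0 < β) (hβ1 : β < 1) {s : ℝ} (hs : 0 < s) :
    Continuous fun a => katoDensityDeriv β a s := by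
  unfold katoDensityDeriv katoDenom
  refine continuous_const.mul ((continuous_const.mul (by continuity)).div (by continuity)
    fun a => ?_)
  exact pow_ne_zero 2 (katoDenom_pos hβ0 hβ1 a hs).ne'

/-- `s ↦ ∂_aρ(s,a)` is measurable. [folklore] -/
theorem measurable_katoDensityDeriv (β a : ℝ) : Measurable (katoDensityDeriv β a) := by
  unfold katoDensityDeriv katoDenom
  fun_prop

end Kato

namespace CovBound

/-! ### Lemma 10.1.4 with `q = 1`: the integrals of `s^γ/(s^β+A)³` -/

/-- The integrand `s^γ/(s^β+A)³` is continuous on `(0,∞)` (`A ≥ 0`). [folklore] -/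
theorem continuousOn_rpow_div_cube {γ β A : ℝ} (hA : 0 ≤ A) {S : Set ℝ} (hS : S ⊆ Ioi 0) :
    ContinuousOn (fun s : ℝ => s ^ γ / (s ^ β + A) ^ 3) S := by
  intro s hs
  have hs0 : 0 < s := hS hs
  refine ContinuousAt.continuousWithinAt ?_
  have h1 : ContinuousAt (fun s : ℝ => s ^ γ) s := Real.continuousAt_rpow_const _ _ (Or.inl hs0.ne')
  have h2 : ContinuousAt (fun s : ℝ => s ^ β) s := Real.continuousAt_rpow_const _ _ (Or.inl hs0.ne')
  exact h1.div ((h2.add continuousAt_const).pow 3)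
    (pow_pos (add_pos_of_pos_of_nonneg (Real.rpow_pos_of_pos hs0 _) hA) 3).ne'

/-- Pointwise: `s^γ/(s^β+A)³ ≤ s^{γ-3β}` (`s > 0`, `A ≥ 0`). [folklore] -/
theorem rpow_div_cube_le_rpow_sub {γ β A s : ℝ} (hs : 0 < s) (hA : 0 ≤ A) :
    s ^ γ / (s ^ β + A) ^ 3 ≤ s ^ (γ - 3 * β) := by
  have hsb : 0 < s ^ β := Real.rpow_pos_of_pos hs _
  have h3 : s ^ (3 * β) = (s ^ β) ^ 3 := by
    rw [mul_comm, Real.rpow_mul hs.le]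
    norm_cast
  rw [Real.rpow_sub hs, h3]
  apply div_le_div_of_nonneg_left (Real.rpow_nonneg hs.le _) (by positivity)
  exact pow_le_pow_left₀ hsb.le (by linarith) 3

/-- Pointwise: `s^γ/(s^β+A)³ ≤ A⁻³ s^γ` (`s > 0`, `A > 0`). [folklore] -/
theorem rpow_div_cube_le_inv_cube_mul {γ β A s : ℝ} (hs : 0 < s) (hA : 0 < A) :
    s ^ γ / (s ^ β + A) ^ 3 ≤ A⁻¹ ^ 3 * s ^ γ := by
  have hsb : 0 < s ^ β := Real.rpow_pos_of_pos hs _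
  rw [inv_pow, inv_mul_eq_div]
  apply div_le_div_of_nonneg_left (Real.rpow_nonneg hs.le _) (by positivity)
  exact pow_le_pow_left₀ hA.le (by linarith) 3

/-- `s^γ/(s^β+A)³` is integrable on `(0,T]` when `γ > -1` and `A > 0`. [folklore] -/
theorem integrableOn_rpow_div_cube_Ioc {γ β A T : ℝ} (hγ : -1 < γ) (hA : 0 < A) (hT : 0 ≤ T) :
    IntegrableOn (fun s : ℝ => s ^ γ / (s ^ β + A) ^ 3) (Ioc 0 T) :=
  integrableOn_of_nonneg_of_le measurableSet_Ioc (continuousOn_rpow_div_cube hA.le fun _ hs => hs.1)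
    ((integrableOn_rpow_Ioc_zero hγ hT).const_mul (A⁻¹ ^ 3)) fun _ hs =>
    ⟨div_nonneg (Real.rpow_nonneg hs.1.le _) (pow_nonneg (add_pos_of_pos_of_nonneg
      (Real.rpow_pos_of_pos hs.1 _) hA.le).le 3), rpow_div_cube_le_inv_cube_mul hs.1 hA⟩

/-- `s^γ/(s^β+A)³` is integrable on `(T,∞)` when `γ - 3β < -1` (`A ≥ 0`, `T > 0`). [folklore] -/
theorem integrableOn_rpow_div_cube_Ioi {γ β A T : ℝ} (hγ : γ - 3 * β < -1) (hA : 0 ≤ A)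
    (hT : 0 < T) : IntegrableOn (fun s : ℝ => s ^ γ / (s ^ β + A) ^ 3) (Ioi T) :=
  integrableOn_of_nonneg_of_le measurableSet_Ioi
    (continuousOn_rpow_div_cube hA fun _ hs => Set.mem_Ioi.2 (lt_trans hT (Set.mem_Ioi.1 hs)))
    (integrableOn_Ioi_rpow_of_lt hγ hT) fun s hs =>
    have hs0 : (0 : ℝ) < s := lt_trans hT (Set.mem_Ioi.1 hs)
    ⟨div_nonneg (Real.rpow_nonneg hs0.le _) (pow_nonneg (add_pos_of_pos_of_nonneg
      (Real.rpow_pos_of_pos hs0 _) hA).le 3), rpow_div_cube_le_rpow_sub hs0 hA⟩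

/-- **Lemma 10.1.4, `I_2` with `q = 1`, case "`A ≤ 1, r > 0`", PROVED for all `A ≥ 0` and any
lower limit `T > 0`**: `∫_T^∞ s^γ/(s^β+A)³ ds ≤ T^{γ-3β+1}/(3β-γ-1)` when `γ - 3β < -1` ("the
integral converges if `A = 0`"). [cite: Slade2017, §10.1 (Lemma 10.1.4, I_2, case A ≤ 1, r > 0; q = 1)] -/
theorem setIntegral_rpow_div_cube_Ioi_le {γ β A T : ℝ} (hγ : γ - 3 * β < -1) (hA : 0 ≤ A)
    (hT : 0 < T) :
    ∫ s in Ioi T, s ^ γ / (s ^ β + A) ^ 3 ≤ T ^ (γ - 3 * β + 1) / (3 * β - γ - 1) := by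
  have hval : ∫ s in Ioi T, s ^ (γ - 3 * β) = T ^ (γ - 3 * β + 1) / (3 * β - γ - 1) := by
    rw [integral_Ioi_rpow_of_lt hγ hT]
    have : γ - 3 * β + 1 ≠ 0 := by linarith
    have : 3 * β - γ - 1 ≠ 0 := by linarith
    field_simp
    ring
  rw [← hval]
  have hg : IntegrableOn (fun s : ℝ => s ^ (γ - 3 * β)) (Ioi T) := integrableOn_Ioi_rpow_of_lt hγ hT
  have hpt : ∀ s ∈ Ioi T, 0 ≤ s ^ γ / (s ^ β + A) ^ 3 ∧
      s ^ γ / (s ^ β + A) ^ 3 ≤ s ^ (γ - 3 * β) := fun s hs =>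
    have hs0 : (0 : ℝ) < s := lt_trans hT hs
    ⟨div_nonneg (Real.rpow_nonneg hs0.le _) (pow_nonneg (add_pos_of_pos_of_nonneg
      (Real.rpow_pos_of_pos hs0 _) hA).le 3), rpow_div_cube_le_rpow_sub hs0 hA⟩
  exact setIntegral_mono_on (integrableOn_of_nonneg_of_le measurableSet_Ioi
    (continuousOn_rpow_div_cube hA fun s hs => Set.mem_Ioi.2 (lt_trans hT (Set.mem_Ioi.1 hs)))
    hg hpt) hg measurableSet_Ioi fun s hs => (hpt s hs).2

/-- **Lemma 10.1.4, `I_1` with `q = 1`, case "`A ≥ 1, γ > -1`"-type bound, PROVED for all `A > 0`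
and any upper limit `T ≥ 0`**: `∫₀^T s^γ/(s^β+A)³ ds ≤ A⁻³T^{γ+1}/(γ+1)` ("from the inequality
`(σ^β+A)^{-2-q} ≤ A^{-2-q}`"). [cite: Slade2017, §10.1 (Lemma 10.1.4, I_1, case A ≥ 1; q = 1)] -/
theorem setIntegral_rpow_div_cube_Ioc_le' {γ β A T : ℝ} (hγ : -1 < γ) (hA : 0 < A) (hT : 0 ≤ T) :
    ∫ s in Ioc (0 : ℝ) T, s ^ γ / (s ^ β + A) ^ 3 ≤ A⁻¹ ^ 3 * T ^ (γ + 1) / (γ + 1) := by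
  have hg := (integrableOn_rpow_Ioc_zero hγ hT).const_mul (A⁻¹ ^ 3)
  have hpt : ∀ s ∈ Ioc (0 : ℝ) T, 0 ≤ s ^ γ / (s ^ β + A) ^ 3 ∧
      s ^ γ / (s ^ β + A) ^ 3 ≤ A⁻¹ ^ 3 * s ^ γ := fun s hs =>
    ⟨div_nonneg (Real.rpow_nonneg hs.1.le _) (pow_nonneg (add_pos_of_pos_of_nonneg
      (Real.rpow_pos_of_pos hs.1 _) hA.le).le 3), rpow_div_cube_le_inv_cube_mul hs.1 hA⟩
  calc ∫ s in Ioc (0 : ℝ) T, s ^ γ / (s ^ β + A) ^ 3 ≤ ∫ s in Ioc (0 : ℝ) T, A⁻¹ ^ 3 * s ^ γ :=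
        setIntegral_mono_on (integrableOn_of_nonneg_of_le measurableSet_Ioc
          (continuousOn_rpow_div_cube hA.le fun s hs => hs.1) hg hpt) hg measurableSet_Ioc
          fun s hs => (hpt s hs).2
    _ = A⁻¹ ^ 3 * T ^ (γ + 1) / (γ + 1) := by
        rw [integral_const_mul, setIntegral_rpow_Ioc_zero hγ hT]
        ring

/-- **Lemma 10.1.4, `I_1` with `q = 1`, case "`A ≤ 1, r > 0`": the scaling bound `∫₀^T
s^γ/(s^β+A)³ ds ≤ (1/(γ+1) + 1/(3β-γ-1)) A^{-r}`, `r = 3 - (γ+1)/β`**, PROVED for every `A > 0`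
and every upper limit `T` when `γ > -1` and `γ + 1 < 3β` (i.e. `r > 0`, `β > 0`) — the
printed proof substitutes `s = σA^{1/β}` ("`I_1 = A^{-r}∫₀^{A^{-1/β}}dσ σ^γ/(σ^β+1)^{2+q} ≲ A^{-r}`");
here the `s`-range is split at `A^{1/β}`, with `(s^β+A)³ ≥ A³` below and `≥ s^{3β}` above.
[cite: Slade2017, §10.1 (Lemma 10.1.4, I_1, case A ≤ 1, r > 0, and its proof; q = 1)] -/
theorem setIntegral_rpow_div_cube_Ioc_le_rpow_neg {γ β A : ℝ} (T : ℝ) (hβ : 0 < β) (hγ : -1 < γ)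
    (hr : γ + 1 < 3 * β) (hA : 0 < A) :
    ∫ s in Ioc (0 : ℝ) T, s ^ γ / (s ^ β + A) ^ 3 ≤
      (1 / (γ + 1) + 1 / (3 * β - γ - 1)) * A ^ (-(3 - (γ + 1) / β)) := by
  set s₀ : ℝ := A ^ (1 / β) with hs₀
  have hs₀0 : 0 < s₀ := Real.rpow_pos_of_pos hA _
  have hγ3 : γ - 3 * β < -1 := by linarith
  set f : ℝ → ℝ := fun s => s ^ γ / (s ^ β + A) ^ 3 with hf
  have hf0 : ∀ s : ℝ, 0 < s → 0 ≤ f s := fun s hs =>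
    div_nonneg (Real.rpow_nonneg hs.le _) (pow_nonneg (add_pos_of_pos_of_nonneg
      (Real.rpow_pos_of_pos hs _) hA.le).le 3)
  have hi1 : IntegrableOn f (Ioc 0 s₀) := integrableOn_rpow_div_cube_Ioc hγ hA hs₀0.le
  have hi2 : IntegrableOn f (Ioi s₀) := integrableOn_rpow_div_cube_Ioi hγ3 hA.le hs₀0
  have hiU : IntegrableOn f (Ioi 0) := by
    rw [← Ioc_union_Ioi_eq_Ioi hs₀0.le]
    exact hi1.union hi2
  -- powers of `s₀`
  have hpow1 : A⁻¹ ^ 3 * s₀ ^ (γ + 1) = A ^ (-(3 - (γ + 1) / β)) := by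
    rw [hs₀, ← Real.rpow_mul hA.le, inv_pow, ← Real.rpow_natCast A 3, ← Real.rpow_neg hA.le,
      ← Real.rpow_add hA]
    congr 1
    field_simp
    ring
  have hpow2 : s₀ ^ (γ - 3 * β + 1) = A ^ (-(3 - (γ + 1) / β)) := by
    rw [hs₀, ← Real.rpow_mul hA.le]
    congr 1
    field_simp
    ring
  have hdisj : Disjoint (Ioc (0 : ℝ) s₀) (Ioi s₀) :=
    Set.disjoint_left.2 fun s (hs : s ∈ Ioc (0 : ℝ) s₀) (hs' : s ∈ Ioi s₀) => not_lt.2 hs.2 hs'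
  calc ∫ s in Ioc (0 : ℝ) T, f s ≤ ∫ s in Ioi 0, f s :=
        setIntegral_mono_set hiU ((ae_restrict_iff' measurableSet_Ioi).2
          (Eventually.of_forall fun s hs => hf0 s hs))
          (Eventually.of_forall fun s (hs : s ∈ Ioc (0 : ℝ) T) => (hs.1 : s ∈ Ioi (0 : ℝ)))
    _ = (∫ s in Ioc (0 : ℝ) s₀, f s) + ∫ s in Ioi s₀, f s := by
        rw [← Ioc_union_Ioi_eq_Ioi hs₀0.le, setIntegral_union hdisj measurableSet_Ioi hi1 hi2]
    _ ≤ A⁻¹ ^ 3 * s₀ ^ (γ + 1) / (γ + 1) + s₀ ^ (γ - 3 * β + 1) / (3 * β - γ - 1) :=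
        add_le_add (setIntegral_rpow_div_cube_Ioc_le' hγ hA hs₀0.le)
          (setIntegral_rpow_div_cube_Ioi_le hγ3 hA.le hs₀0)
    _ = (1 / (γ + 1) + 1 / (3 * β - γ - 1)) * A ^ (-(3 - (γ + 1) / β)) := by
        rw [hpow1, hpow2]
        ring

end CovBound

namespace FRD

open Literature.Probability.LatticeModels

variable {d : ℕ}

/-! ### The mass derivative of `C_j` -/

/-- `s ↦ s^{-β}/(2d+s)` times a constant dominates; integrability of the dominating function of the
mass derivative: `IntegrableOn (s ↦ K s^{-β}/(2d+s)) (0,∞)`. [folklore] -/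
theorem integrableOn_const_mul_rpow_neg_div (hd : 1 ≤ d) {β : ℝ} (hβ0 : 0 < β) (hβ1 : β < 1) (K : ℝ) :
    IntegrableOn (fun s : ℝ => K * (s ^ (-β) / (2 * d + s))) (Ioi 0) :=
  (integrableOn_rpow_neg_div hd hβ0 hβ1).const_mul K

/-- **`∂C_{j;0,x}(m²)/∂m² = ∫₀^∞ Γ_{j;0,x}(s) ∂_Aρ^{(α/2)}(s,m²) ds` for `m² > 0`** — differentiation
under the Kato integral (3.8), justified by dominated convergence: for `A` in `(m²/2, 3m²/2)` the
integrand's `A`-derivative is bounded by `c (2/m²) s^{-α/2} |Γ_j(s)| ≤ c' s^{-α/2}/(2d+s)`,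
integrable on `(0,∞)`. This is the object estimated in the `q = 1` case of Proposition 10.1.1
("we consider these together, with `q ∈ {0,1}` denoting the number of `m²`-derivatives").
[cite: Slade2017, Proposition 3.3.1 (the ∂/∂m² display) and §10.1 (proof of Proposition 10.1.1, q = 1)] -/
theorem hasDerivAt_fracCov_mass (hd : 1 ≤ d) {α : ℝ} (hα0 : 0 < α) (hα2 : α < 2) {L : ℝ} (hL : 2 ≤ L)
    {m2 : ℝ} (hm2 : 0 < m2) {j : ℕ} (hj : 1 ≤ j) (x : Site d) :
    IntegrableOn (fun s : ℝ => Gam d L s j x * Kato.katoDensityDeriv (α / 2) m2 s) (Ioi 0) ∧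
    HasDerivAt (fun a : ℝ => fracCov d L α a j x)
      (∫ s in Ioi 0, Gam d L s j x * Kato.katoDensityDeriv (α / 2) m2 s) m2 := by
  have hβ0 : 0 < α / 2 := by positivity
  have hβ1 : α / 2 < 1 := by linarith
  have hL1 : (1 : ℝ) < L := by linarith
  obtain ⟨c, hc, hG⟩ := abs_Gam_le hd 0
  obtain ⟨Cj, hCj⟩ : ∃ Cj : ℝ, Cj = c * (∫ τ in Ioc (1 / 2 : ℝ) (L / 2), τ / τ ^ d) *
      ((L ^ (j - 1)) ^ 2 / (L ^ (j - 1)) ^ d) := ⟨_, rfl⟩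
  have hF0 : 0 ≤ ∫ τ in Ioc (1 / 2 : ℝ) (L / 2), τ / τ ^ d :=
    setIntegral_nonneg measurableSet_Ioc fun τ hτ => by
      have : (0 : ℝ) < τ := by linarith [hτ.1]
      positivity
  have hCj0 : 0 ≤ Cj := by
    rw [hCj]
    have : (0 : ℝ) ≤ L := by linarith
    positivity
  have hGam : ∀ s : ℝ, 0 < s → |Gam d L s j x| ≤ Cj / (2 * d + s) := by
    intro s hs
    have h := hG L hL s hs j hj x
    simp only [pow_zero, inv_one, mul_one] at h
    calc |Gam d L s j x| ≤ c * (∫ τ in Ioc (1 / 2 : ℝ) (L / 2), τ / τ ^ d) * (1 / (2 * d + s)) *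
          ((L ^ (j - 1)) ^ 2 / (L ^ (j - 1)) ^ d) := h
      _ = Cj / (2 * d + s) := by rw [hCj]; ring
  -- the constant of (10.9), second bound
  set Cρ : ℝ := 8 * Real.sin (π * (α / 2)) / (π * (1 + Real.cos (π * (α / 2))) ^ 2) with hCρ
  have hsin : 0 < Real.sin (π * (α / 2)) := Real.sin_pos_of_pos_of_lt_pi (by positivity)
    (by nlinarith [Real.pi_pos])
  have hκ := Kato.one_add_cos_pos hβ0 hβ1
  have hCρ0 : 0 ≤ Cρ := by rw [hCρ]; positivity
  set bound : ℝ → ℝ := fun s => Cj * Cρ * (2 / m2) * (s ^ (-(α / 2)) / (2 * d + s)) with hbound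
  have key := hasDerivAt_integral_of_dominated_loc_of_deriv_le
    (μ := (volume : Measure ℝ).restrict (Ioi 0)) (x₀ := m2)
    (F := fun a s => Gam d L s j x * Kato.katoDensity (α / 2) a s)
    (F' := fun a s => Gam d L s j x * Kato.katoDensityDeriv (α / 2) a s)
    (bound := bound) (s := Ioi (m2 / 2)) (Ioi_mem_nhds (by linarith))
    (Eventually.of_forall fun a =>
      ((measurable_Gam L j x).mul (Kato.measurable_katoDensity (α / 2) a)).aestronglyMeasurable)
    (integrableOn_Gam_mul_katoDensity hd hβ0 hβ1 hL1 hm2 hj x)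
    (((measurable_Gam L j x).mul (Kato.measurable_katoDensityDeriv (α / 2) m2)).aestronglyMeasurable)
    ((ae_restrict_iff' measurableSet_Ioi).2 (Eventually.of_forall fun s hs a ha => ?_))
    (((integrableOn_rpow_neg_div hd hβ0 hβ1).const_mul (Cj * Cρ * (2 / m2))))
    ((ae_restrict_iff' measurableSet_Ioi).2 (Eventually.of_forall fun s hs a _ =>
      (Kato.hasDerivAt_katoDensity_mass hβ0 hβ1 hs a).const_mul (Gam d L s j x)))
  · exact ⟨key.1, key.2⟩
  · -- the domination on the ball `|a - m²| < m²/2`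
    have hs : (0 : ℝ) < s := hs
    have ha' : m2 / 2 < a := ha
    have ha0 : 0 < a := by linarith
    have hd0 : (0 : ℝ) < 2 * d + s := by positivity
    rw [Real.norm_eq_abs, abs_mul, hbound]
    have hρ' := Kato.abs_katoDensityDeriv_le_inv_mul_rpow_neg hβ0 hβ1 ha0 hs
    have hainv : a⁻¹ ≤ 2 / m2 := by
      rw [inv_le_comm₀ ha0 (by positivity)]
      rw [inv_div]
      linarith
    calc |Gam d L s j x| * |Kato.katoDensityDeriv (α / 2) a s|
        ≤ Cj / (2 * d + s) * (Cρ * (a⁻¹ * s ^ (-(α / 2)))) :=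
          mul_le_mul (hGam s hs) hρ' (abs_nonneg _) (div_nonneg hCj0 hd0.le)
      _ ≤ Cj / (2 * d + s) * (Cρ * (2 / m2 * s ^ (-(α / 2)))) := by
          gcongr
      _ = Cj * Cρ * (2 / m2) * (s ^ (-(α / 2)) / (2 * d + s)) := by ring

/-- The integrand of the printed `q = 1` estimate is integrable: `s ↦ |Γ_{j;0,x}(s)| s^β/(s^β+m²)³`
on `(0,∞)` for `m² > 0` (dominated by `c m⁻² s^{-β}/(2d+s)`).
[cite: Slade2017, §10.1 (proof of Proposition 10.1.1, q = 1)] -/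
theorem integrableOn_abs_Gam_mul_rpow_div_cube (hd : 1 ≤ d) {β : ℝ} (hβ0 : 0 < β) (hβ1 : β < 1)
    {L : ℝ} (hL : 2 ≤ L) {m2 : ℝ} (hm2 : 0 < m2) {j : ℕ} (hj : 1 ≤ j) (x : Site d) :
    IntegrableOn (fun s : ℝ => |Gam d L s j x| * (s ^ β / (s ^ β + m2) ^ 3)) (Ioi 0) := by
  obtain ⟨c, hc, hG⟩ := abs_Gam_le hd 0
  obtain ⟨Cj, hCj⟩ : ∃ Cj : ℝ, Cj = c * (∫ τ in Ioc (1 / 2 : ℝ) (L / 2), τ / τ ^ d) *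
      ((L ^ (j - 1)) ^ 2 / (L ^ (j - 1)) ^ d) := ⟨_, rfl⟩
  have hF0 : 0 ≤ ∫ τ in Ioc (1 / 2 : ℝ) (L / 2), τ / τ ^ d :=
    setIntegral_nonneg measurableSet_Ioc fun τ hτ => by
      have : (0 : ℝ) < τ := by linarith [hτ.1]
      positivity
  have hCj0 : 0 ≤ Cj := by
    rw [hCj]
    have : (0 : ℝ) ≤ L := by linarith
    positivity
  have hGam : ∀ s : ℝ, 0 < s → |Gam d L s j x| ≤ Cj / (2 * d + s) := by
    intro s hs
    have h := hG L hL s hs j hj x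
    simp only [pow_zero, inv_one, mul_one] at h
    calc |Gam d L s j x| ≤ c * (∫ τ in Ioc (1 / 2 : ℝ) (L / 2), τ / τ ^ d) * (1 / (2 * d + s)) *
          ((L ^ (j - 1)) ^ 2 / (L ^ (j - 1)) ^ d) := h
      _ = Cj / (2 * d + s) := by rw [hCj]; ring
  have hmeas : Measurable fun s : ℝ => |Gam d L s j x| * (s ^ β / (s ^ β + m2) ^ 3) :=
    (measurable_Gam L j x).abs.mul (by fun_prop)
  refine Integrable.mono' ((integrableOn_rpow_neg_div hd hβ0 hβ1).const_mul (Cj * m2⁻¹))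
    hmeas.aestronglyMeasurable ((ae_restrict_iff' measurableSet_Ioi).2 (Eventually.of_forall
      fun s hs => ?_))
  have hs : (0 : ℝ) < s := hs
  have hsb : 0 < s ^ β := Real.rpow_pos_of_pos hs _
  have hS : 0 < s ^ β + m2 := by linarith
  have hd0 : (0 : ℝ) < 2 * d + s := by positivity
  rw [Real.norm_eq_abs, abs_mul, abs_abs, abs_of_nonneg (by positivity : 0 ≤ s ^ β / (s ^ β + m2) ^ 3)]
  -- s^β/(s^β+m²)³ ≤ m⁻² s^{-β}
  have hfrac : s ^ β / (s ^ β + m2) ^ 3 ≤ m2⁻¹ * s ^ (-β) := by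
    rw [Real.rpow_neg hs.le, div_le_iff₀ (pow_pos hS 3)]
    have h1 : s ^ β * s ^ β * m2 ≤ (s ^ β + m2) ^ 3 := by
      calc s ^ β * s ^ β * m2 = m2 * (s ^ β) ^ 2 := by ring
        _ ≤ (s ^ β + m2) * (s ^ β + m2) ^ 2 :=
            mul_le_mul (by linarith) (pow_le_pow_left₀ hsb.le (by linarith) 2) (sq_nonneg _) hS.le
        _ = (s ^ β + m2) ^ 3 := by ring
    calc s ^ β = m2⁻¹ * (s ^ β)⁻¹ * (s ^ β * s ^ β * m2) := by field_simp
      _ ≤ m2⁻¹ * (s ^ β)⁻¹ * (s ^ β + m2) ^ 3 := by gcongr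
  calc |Gam d L s j x| * (s ^ β / (s ^ β + m2) ^ 3) ≤ Cj / (2 * d + s) * (m2⁻¹ * s ^ (-β)) :=
        mul_le_mul (hGam s hs) hfrac (by positivity) (div_nonneg hCj0 hd0.le)
    _ = Cj * m2⁻¹ * (s ^ (-β) / (2 * d + s)) := by ring

/-- **`|∂C_{j;0,x}/∂m²| ≤ c_β ∫₀^∞ |Γ_{j;0,x}(s)| s^β/(s^β+m²)³ ds`** (`β = α/2`, `m² > 0`): the
starting point of the `q = 1` case of the proof of Proposition 10.1.1 (the `s`-integral of (10.1)
with `ρ` replaced by the bound (10.9) on `|∂ρ/∂A|`).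
[cite: Slade2017, §10.1 (proof of Proposition 10.1.1: displays (10.9), (10.11)–(10.12) with q = 1)] -/
theorem abs_deriv_fracCov_mass_le (hd : 1 ≤ d) {α : ℝ} (hα0 : 0 < α) (hα2 : α < 2) {L : ℝ}
    (hL : 2 ≤ L) {m2 : ℝ} (hm2 : 0 < m2) {j : ℕ} (hj : 1 ≤ j) (x : Site d) :
    |∫ s in Ioi 0, Gam d L s j x * Kato.katoDensityDeriv (α / 2) m2 s| ≤
      8 * Real.sin (π * (α / 2)) / (π * (1 + Real.cos (π * (α / 2))) ^ 2) *
        ∫ s in Ioi 0, |Gam d L s j x| * (s ^ (α / 2) / (s ^ (α / 2) + m2) ^ 3) := by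
  have hβ0 : 0 < α / 2 := by positivity
  have hβ1 : α / 2 < 1 := by linarith
  set Cρ : ℝ := 8 * Real.sin (π * (α / 2)) / (π * (1 + Real.cos (π * (α / 2))) ^ 2) with hCρ
  have hint := integrableOn_abs_Gam_mul_rpow_div_cube hd hβ0 hβ1 hL hm2 hj x
  rw [← integral_const_mul]
  refine abs_integral_le_integral_abs.trans (setIntegral_mono_on (hasDerivAt_fracCov_mass hd hα0
    hα2 hL hm2 hj x).1.abs (hint.const_mul Cρ) measurableSet_Ioi fun s hs => ?_)
  have hs : (0 : ℝ) < s := hs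
  rw [abs_mul]
  calc |Gam d L s j x| * |Kato.katoDensityDeriv (α / 2) m2 s|
      ≤ |Gam d L s j x| * (Cρ * (s ^ (α / 2) / (s ^ (α / 2) + m2) ^ 3)) :=
        mul_le_mul_of_nonneg_left (Kato.abs_katoDensityDeriv_le hβ0 hβ1 hm2.le hs) (abs_nonneg _)
    _ = Cρ * (|Gam d L s j x| * (s ^ (α / 2) / (s ^ (α / 2) + m2) ^ 3)) := by ring

end FRD

end LongRangePhi4

end Literature.Barriers.CriticalPhenomena
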